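import Literature.MathematicalPhysics.QuantumFieldTheory.Balaban1983to89.B13Bound226CentredUnscaled
import Literature.MathematicalPhysics.QuantumFieldTheory.Balaban1983to89.B13Bound226BoxTail

/-!
# `Balaban1983to89.B13Term214WindowDilatedUnscaled` — T. Bałaban, *Renormalization group approach to lattice gauge field
theories. II. Cluster expansions*, Commun. Math. Phys. **116** (1988) 1–22 [Balaban1988RG2Cluster], pp. 12, 15–17 (with (1.20)
p. 6, (1.42) p. 11), and [Balaban1987RG1] (2.9)–(2.13) pp. 266–268: (2.26) AND HOLOMORPHY IN THE MEMBER PARAMETER ALONG THE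
WINDOW-DILATED FAMILY OF THE UNSCALED-FIELD LAW `b ↦ b²·s⁻²𝒲(Y,sB) + 𝒪(Y,sB)` FROM print-SHAPED **LOCAL** GROWTH LETTERS — the
composition of `B13Term214WindowDilated.h226_torus_windowDilated_of_primitives` ∕
`differentiableOn_term214_torus_windowDilated_of_primitives` (node N22's (S-last-T′) per term: the bound and the holomorphy on the
ball `|b − 1| < ρ_b`) with the coordinatewise clipping device of `B13ClippedFieldLetters` and the PER-BOND (2.20) rate of
`B13Bound226CentredUnscaled` §3: the engines' JOINT (2.20) letter `Σ|τ(Y)|(|W| + |O|) ≤ ½a₂₀B·B + w` for ALL `B` — which the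
unclipped Wilson remainder (cubic at the origin) cannot meet at a small rate — is met by the clipped split pair
`(s⁻²𝒲(Y, clip ρ(sB)), 𝒪(Y, clip ρ(sB)))` with the volume-free rate `a₂₀ = 2ρ·m₃`, and `F214` does not see the clipping

statement-level skeleton of published theorems with citation tags; proofs where landed; nothing here is a claim about the
Yang–Mills mass gap

PDF held: `paper:balaban1988-cmp116-rg-ii-cluster` (journal page = PDF page + 0), pp. 6, 11–12, 15–17; `paper:balaban1987-cmp109-rg-i`
pp. 266–268.

CITATION HEADER.  [II] p. 16 L17–27: (2.20) is derived from (1.42) ON the domain (1.20) «g_k|B| < ε₁» and used under `χ_{k,Y₀}`,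
the quadratic forms «resummed over all Y∈𝐃_k containing, for example, the point b₋ … this yields a constant O(1)»; [I] p. 267
after (2.12): *"Next we make the scaling transformation B = g_kB′ …"*.  NOT PRINTED: the complex member parameter `b` (the
tree's window-dilation device, `B13Term214WindowDilated`); what is recorded is that the tree's `∀ B` letters of that engine are met
from print's LOCAL regime by the clipped twin.

PROVENANCE.  Composition recipe = the lens's §21.3∕§23 (seat `ym-lens-BalabanUVNodes-transfer`, Cards T27∕T29, errata E6∕E8); the
typing is this seat's.  Cell `pub-ymgap`, seat `pub-ymgap-dag-n10-c` (g7), node N10 [B13]; consumer: node N22's J6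
(`Summits/…/BalabanUVNodesN22W1RelCentredMembersOfDatumBound`, which displays the joint (2.20) letter of the UNclipped member for
all `B`), the unseated N09 ∕ Lemma-2 successor and the W1 definer's located-inputs storey (W1-12).

WHAT IS HERE (no definition).
* §1 `measurable_Wclip`, `measurable_Oclip`, `h220U_clip_perBond_split` (the JOINT (2.20) letter of the clipped split pair with the
  per-bond rate `2ρ·m₃` and the weighted constant `Σ_Y R(Y)(c₀(Y) + c₁(Y)ρ)`), `F214_clip_eq_member` (for every complex `b`,
  `F214(b²·Wclip + Oclip) = F214(b²·W + O)` under the box-support law and `Y`-locality).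
* §2 ★ `h226_torus_windowDilated_of_localGrowth_perBond`: (2.26) for EVERY member of the ball, for the law's member family
  `fun Y B => b^2 * ((s:ℂ)^2)⁻¹ * 𝒲 Y (s • B)) + 𝒪 Y (s • B)`, from the LOCAL letters (L0), (ℓ1), (L4) with per-domain constants,
  τ-radii `R(Y)`, bond supports, per-bond multiplicity, box law, locality; the primed letters `a′ ≥ (1+ρ_b)²·2ρm₃`,
  `w′ ≥ (1+ρ_b)²·ΣR(c₀ + c₁ρ)`.
* §3 ★ `differentiableOn_term214_torus_windowDilated_of_localGrowth_perBond`: holomorphy in `b` on the ball, same hypotheses.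
HONEST SCOPE.  Composition only; no estimate new in kind.  The LOCAL letters, radii, bond supports, multiplicity, box law and
locality are the PRODUCER's data about the datum — hypotheses here.  Nothing of Bałaban's kernels or potentials is constructed;
N10∕N22∕N09 NOT discharged.  No `sorry`, no definition, no new named fact (D-0026).
-/

noncomputable section

namespace Literature.MathematicalPhysics.QuantumFieldTheory.Balaban1983to89.B13Term214WindowDilatedUnscaled

open Matrix MeasureTheory Finset Complex Metric Set
open scoped Real
open B13Term214 (core214 F214 term214)
open B13Term214WindowDilated (h226_torus_windowDilated_of_primitives differentiableOn_term214_torus_windowDilated_of_primitives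
  differentiableOn_term214_torus_windowDilated_history_of_primitives)
open B13ClippedFieldLetters (clip clip_apply_of_abs_le norm_clip_le measurable_clip_smul F214_congr_on_support)
open B13Bound226CentredUnscaled (h220_clip_pointwise_loc sum_weight_localSq_le)
open TreeLengthTorus (TPt TDom tsys)
open TreeLengthTorusTransfer (tclosure)
open B13Lemma3TorusData (TBond)
open B13Lemma3TorusTerms (weight Z0)
open B13Bound143 (invTau)
open B5TorusCover (UT)
open B9Thm37GlueTorus (tdist1)

/-! ## §1. The clipped split pair: measurability, the joint (2.20) letter with the per-bond rate, and `F214` does not see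
the clipping at any member `b` -/

section Split

variable {Λ : Type} [Fintype Λ]
variable {D : Type*}

/-- The clipped Wilson part `B ↦ s⁻²𝒲(Y, clip ρ(sB))` is measurable when `𝒲(Y,·)` is — the engine's `hWm` binder.
[cite: Balaban1988RG2Cluster, (2.14) p.15] (elementary API for (2.14)) -/
theorem measurable_Wclip {𝒲 : D → (Λ → ℝ) → ℂ} (ρ s : ℝ) (h𝒲m : ∀ Y, Measurable (𝒲 Y)) (Y : D) :
    Measurable (fun B : Λ → ℝ => (((s : ℝ) : ℂ) ^ 2)⁻¹ * 𝒲 Y (clip ρ (s • B))) :=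
  ((h𝒲m Y).comp (measurable_clip_smul ρ s)).const_mul _

/-- The clipped older terms `B ↦ 𝒪(Y, clip ρ(sB))` are measurable when `𝒪(Y,·)` is — the engine's `hOm` binder.
[cite: Balaban1988RG2Cluster, (2.14) p.15] (elementary API for (2.14)) -/
theorem measurable_Oclip {𝒪 : D → (Λ → ℝ) → ℂ} (ρ s : ℝ) (h𝒪m : ∀ Y, Measurable (𝒪 Y)) (Y : D) :
    Measurable (fun B : Λ → ℝ => 𝒪 Y (clip ρ (s • B))) :=
  (h𝒪m Y).comp (measurable_clip_smul ρ s)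

/-- **THE JOINT (2.20) LETTER OF THE CLIPPED SPLIT PAIR WITH THE PER-BOND RATE** — the `h220U` binder of
`B13Term214WindowDilated.h226_torus_windowDilated_of_primitives` ∕ `differentiableOn_term214_torus_windowDilated_of_primitives`
(`Σ|τ(Y)|(|W| + |O|) ≤ ½a₂₀B·B + w` for all `B`) for `W := s⁻²𝒲(Y, clip ρ(s·))`, `O := 𝒪(Y, clip ρ(s·))`: from the per-domain
τ-radii `R(Y)`, the LOCAL letters (L0) `‖𝒪(Y,0)‖ ≤ c₀(Y)`, (ℓ1) `‖𝒲(Y,A)‖ ≤ c₃(Y)‖A‖Σ_{b∈S Y}A_b²`, (L4) `‖𝒪(Y,A) − 𝒪(Y,0)‖ ≤ c₁(Y)‖A‖`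
on the sup-ball `‖A‖ ≤ ρ` and the PER-BOND multiplicity `∀ b, Σ_{Y∋b} R(Y)c₃(Y) ≤ m₃`: for every `s > 0` and EVERY `B`,
`Σ_Y |τ Y|(‖W Y B‖ + ‖O Y B‖) ≤ ½(2ρ·m₃)·B·B + Σ_Y R(Y)(c₀(Y) + c₁(Y)ρ)` — the twin of
`B13Bound226CentredUnscaled.h220U_clip_perBond` for the split reading. [cite: Balaban1988RG2Cluster, (2.19)–(2.20) p.16, (1.42) p.11, (1.20) p.6, (2.14) p.15; Balaban1987RG1, (2.9)–(2.13) pp.266–268] -/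
theorem h220U_clip_perBond_split [DecidableEq Λ] {𝒲 𝒪 : D → (Λ → ℝ) → ℂ} (Dfam : Finset D) (Uτ : D → Set ℂ)
    (S : D → Finset Λ) {R c₀ c₁ c₃ : D → ℝ} {ρ s m₃ : ℝ} (hs : 0 < s) (hρ : 0 ≤ ρ)
    (hR : ∀ Y ∈ Dfam, 0 ≤ R Y) (hc₃ : ∀ Y ∈ Dfam, 0 ≤ c₃ Y) (hc₁ : ∀ Y ∈ Dfam, 0 ≤ c₁ Y)
    (hUτ : ∀ Y ∈ Dfam, ∀ z ∈ Uτ Y, ‖z‖ ≤ R Y) (h0 : ∀ Y ∈ Dfam, ‖𝒪 Y 0‖ ≤ c₀ Y)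
    (h1loc : ∀ Y ∈ Dfam, ∀ A, ‖A‖ ≤ ρ → ‖𝒲 Y A‖ ≤ c₃ Y * ‖A‖ * ∑ b ∈ S Y, A b ^ 2)
    (h4 : ∀ Y ∈ Dfam, ∀ A, ‖A‖ ≤ ρ → ‖𝒪 Y A - 𝒪 Y 0‖ ≤ c₁ Y * ‖A‖)
    (hm₃ : ∀ bd, ∑ Y ∈ Dfam with bd ∈ S Y, R Y * c₃ Y ≤ m₃) :
    ∀ τ : D → ℂ, (∀ Y, τ Y ∈ Uτ Y) → ∀ B : Λ → ℝ,
      ∑ Y ∈ Dfam, ‖τ Y‖ * (‖(((s : ℝ) : ℂ) ^ 2)⁻¹ * 𝒲 Y (clip ρ (s • B))‖ + ‖𝒪 Y (clip ρ (s • B))‖)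
        ≤ (2 * ρ * m₃) / 2 * (B ⬝ᵥ B) + ∑ Y ∈ Dfam, R Y * (c₀ Y + c₁ Y * ρ) := by
  intro τ hτ B
  have hE : ∀ Y ∈ Dfam, ‖τ Y‖ * (‖(((s : ℝ) : ℂ) ^ 2)⁻¹ * 𝒲 Y (clip ρ (s • B))‖ + ‖𝒪 Y (clip ρ (s • B))‖)
      ≤ (R Y * c₃ Y) * (ρ * ∑ b ∈ S Y, B b ^ 2) + R Y * (c₀ Y + c₁ Y * ρ) := by
    intro Y hY
    have hO : ‖𝒪 Y (clip ρ (s • B))‖ ≤ c₀ Y + c₁ Y * ρ := by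
      have hd : ‖𝒪 Y (clip ρ (s • B)) - 𝒪 Y 0‖ ≤ c₁ Y * ρ :=
        (h4 Y hY _ (norm_clip_le hρ _)).trans (mul_le_mul_of_nonneg_left (norm_clip_le hρ _) (hc₁ Y hY))
      calc ‖𝒪 Y (clip ρ (s • B))‖ = ‖𝒪 Y 0 + (𝒪 Y (clip ρ (s • B)) - 𝒪 Y 0)‖ := by rw [add_sub_cancel]
        _ ≤ ‖𝒪 Y 0‖ + ‖𝒪 Y (clip ρ (s • B)) - 𝒪 Y 0‖ := norm_add_le _ _
        _ ≤ c₀ Y + c₁ Y * ρ := add_le_add (h0 Y hY) hd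
    have hW : ‖(((s : ℝ) : ℂ) ^ 2)⁻¹ * 𝒲 Y (clip ρ (s • B))‖ ≤ c₃ Y * ρ * ∑ b ∈ S Y, B b ^ 2 :=
      h220_clip_pointwise_loc (S Y) hs hρ (hc₃ Y hY) (h1loc Y hY) B
    calc ‖τ Y‖ * (‖(((s : ℝ) : ℂ) ^ 2)⁻¹ * 𝒲 Y (clip ρ (s • B))‖ + ‖𝒪 Y (clip ρ (s • B))‖)
        ≤ R Y * (c₃ Y * ρ * ∑ b ∈ S Y, B b ^ 2 + (c₀ Y + c₁ Y * ρ)) :=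
          mul_le_mul (hUτ Y hY _ (hτ Y)) (add_le_add hW hO) (by positivity) (hR Y hY)
      _ = (R Y * c₃ Y) * (ρ * ∑ b ∈ S Y, B b ^ 2) + R Y * (c₀ Y + c₁ Y * ρ) := by ring
  calc ∑ Y ∈ Dfam, ‖τ Y‖ * (‖(((s : ℝ) : ℂ) ^ 2)⁻¹ * 𝒲 Y (clip ρ (s • B))‖ + ‖𝒪 Y (clip ρ (s • B))‖)
      ≤ ∑ Y ∈ Dfam, ((R Y * c₃ Y) * (ρ * ∑ b ∈ S Y, B b ^ 2) + R Y * (c₀ Y + c₁ Y * ρ)) := Finset.sum_le_sum hE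
    _ = ρ * ∑ Y ∈ Dfam, (R Y * c₃ Y) * ∑ b ∈ S Y, B b ^ 2 + ∑ Y ∈ Dfam, R Y * (c₀ Y + c₁ Y * ρ) := by
        rw [Finset.sum_add_distrib, Finset.mul_sum]
        congr 1
        exact Finset.sum_congr rfl fun Y _ => by ring
    _ ≤ ρ * (m₃ * (B ⬝ᵥ B)) + ∑ Y ∈ Dfam, R Y * (c₀ Y + c₁ Y * ρ) :=
        add_le_add (mul_le_mul_of_nonneg_left (sum_weight_localSq_le Dfam S hm₃ B) hρ) le_rfl
    _ = (2 * ρ * m₃) / 2 * (B ⬝ᵥ B) + ∑ Y ∈ Dfam, R Y * (c₀ Y + c₁ Y * ρ) := by ring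

omit [Fintype Λ] in
/-- **`F214` DOES NOT SEE THE CLIPPING AT ANY MEMBER `b`**: under the box-support law `χ_{Y₀}(B) ≠ 0 → |sB(b)| ≤ ρ` on `S₀` and
the `Y`-locality of `𝒲(Y,·)`, `𝒪(Y,·)` in `S₀`, the (2.14) last line of the member `b²·s⁻²𝒲(Y, clip ρ(sB)) + 𝒪(Y, clip ρ(sB))`
equals that of `b²·s⁻²𝒲(Y,sB) + 𝒪(Y,sB)`, as functions of `(τ, B)` (`B13ClippedFieldLetters.F214_congr_on_support`).
[cite: Balaban1988RG2Cluster, (2.2)–(2.3) p.12, (2.14) p.15; Balaban1987RG1, (2.9) p.266] -/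
theorem F214_clip_eq_member {𝒲 𝒪 : D → (Λ → ℝ) → ℂ} {ρ s : ℝ} (cardP : ℕ) (χY₀ χcP : (Λ → ℝ) → ℝ) (Dfam : Finset D)
    (S₀ : Set Λ) (hbox : ∀ B, χY₀ B ≠ 0 → ∀ b ∈ S₀, |(s • B) b| ≤ ρ)
    (hloc𝒲 : ∀ Y ∈ Dfam, ∀ A A' : Λ → ℝ, (∀ b ∈ S₀, A b = A' b) → 𝒲 Y A = 𝒲 Y A')
    (hloc𝒪 : ∀ Y ∈ Dfam, ∀ A A' : Λ → ℝ, (∀ b ∈ S₀, A b = A' b) → 𝒪 Y A = 𝒪 Y A') (b : ℂ) :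
    F214 cardP χY₀ χcP Dfam
        (fun Y B => b ^ 2 * ((((s : ℝ) : ℂ) ^ 2)⁻¹ * 𝒲 Y (clip ρ (s • B))) + 𝒪 Y (clip ρ (s • B)))
      = F214 cardP χY₀ χcP Dfam (fun Y B => b ^ 2 * ((((s : ℝ) : ℂ) ^ 2)⁻¹ * 𝒲 Y (s • B)) + 𝒪 Y (s • B)) := by
  funext τ B
  refine F214_congr_on_support cardP χY₀ χcP Dfam (fun B hχ Y hY => ?_) τ B
  have hagree : ∀ b' ∈ S₀, clip ρ (s • B) b' = (s • B) b' := fun b' hb' => clip_apply_of_abs_le (hbox B hχ b' hb')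
  rw [hloc𝒲 Y hY _ _ hagree, hloc𝒪 Y hY _ _ hagree]

end Split

/-! ## §2. (2.26) along the window-dilated family of the unscaled-field law, from LOCAL growth letters (per-bond rate) -/

section Torus

variable {d L N' : ℕ} [NeZero L] [NeZero N'] {M : ℕ}
variable {ν : ℕ} {Nf : Fin ν → ℕ} [∀ i, NeZero (Nf i)]
variable {Λ : Type} [Fintype Λ] [DecidableEq Λ] {C₀ : Type} [Fintype C₀] [DecidableEq C₀]

open Classical in
/-- **(2.26) ALONG THE WINDOW-DILATED FAMILY OF THE UNSCALED-FIELD LAW, FROM LOCAL GROWTH LETTERS** (node N22's (S-last-T′)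
bound per term, for the member family `b ↦ b²·s⁻²𝒲(Y,sB) + 𝒪(Y,sB)` of [I] p. 267 at a real base point `s > 0`).  Data and
letters AT THE REAL COUPLING as in `B13Term214WindowDilated.h226_torus_windowDilated_of_primitives` (kernels, boxes with (2.22),
references, the (L17a)∕(L16a) letters on the open σ-polydisc, `K_E`, `ρ_b < 1`, primed letters, numeric conditions, `hvol`),
and for the last line ONLY: the coupling-free `𝒲, 𝒪` (measurable in the field), per-domain τ-radii `R(Y)`, the LOCAL letters
(L0) `‖𝒪(Y,0)‖ ≤ c₀(Y)`, (ℓ1) `‖𝒲(Y,A)‖ ≤ c₃(Y)‖A‖Σ_{b∈S Y}A_b²`, (L4) `‖𝒪(Y,A) − 𝒪(Y,0)‖ ≤ c₁(Y)‖A‖` on the sup-ball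
`‖A‖ ≤ ρ`, bond supports `S Y`, the PER-BOND multiplicity `m₃`, the box-support law at the coupling and the `Y`-locality of the
potentials; the primed (2.20) letters `a′ ≥ (1+ρ_b)²·2ρm₃`, `w′ ≥ (1+ρ_b)²·Σ_Y R(Y)(c₀(Y) + c₁(Y)ρ)`.  Conclusion: for every `b`
of the ball, `‖(2.14)_b‖ ≤ weight L M c Z a t·exp(a₅|Z|)`.  Proof: the cited engine on the CLIPPED split pair (§1
`h220U_clip_perBond_split`, `measurable_Wclip∕Oclip`), then `F214_clip_eq_member`.
[cite: Balaban1988RG2Cluster, (2.14)–(2.15) p.15, (2.16)–(2.22) p.16, (2.23)–(2.26) p.17, (2.2)–(2.3) p.12, (1.42) p.11, (1.20) p.6; Balaban1987RG1, (2.9)–(2.13) pp.266–268] -/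
theorem h226_torus_windowDilated_of_localGrowth_perBond (c : B13.Consts) (hκ₁ : 1 ≤ c.κ₁) (hα₆ : c.α₆ ≠ 0)
    (Z : TDom d N') (t : Finset (TDom d (L * N')) × Finset (TBond d M (L * N')))
    (hpos : ∀ Y : TDom d (L * N'), 0 < invTau c ((tsys d (L * N')).dj Y))
    (hhalf : ∀ Y : TDom d (L * N'), invTau c ((tsys d (L * N')).dj Y) ≤ 1 / 2)
    {Uσ : Set ℂ} {Uτ : TDom d (L * N') → Set ℂ} (hUσ : IsOpen Uσ) (hUτ : ∀ Y, IsOpen (Uτ Y))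
    (hUexp : closedBall (0 : ℂ) (Real.exp c.κ₁) ⊆ Uσ)
    (hUtau : ∀ Y : TDom d (L * N'), closedBall (0 : ℂ) ((invTau c ((tsys d (L * N')).dj Y))⁻¹) ⊆ Uτ Y)
    {r : ℝ} (hr : 0 < r) (hr' : r ≤ Real.exp c.κ₁ - 1)
    (hsubτ : ∀ Y, ∀ s ∈ Set.uIcc (0 : ℝ) 1, closedBall (s : ℂ) r ⊆ Uτ Y)
    -- the parameter lists of the term: σ over the blocks of Z∖Z′₀, τ over 𝐃
    (lZ : List (TPt d N')) (hlZ : lZ.Nodup ∧ lZ.toFinset = Z.1 \ tclosure L N' (Z0 M t))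
    (lD : List (TDom d (L * N'))) (hlD : lD.Nodup ∧ lD.toFinset = t.1)
    -- the (2.14)-data of the term AT THE REAL COUPLING (b = 1)
    (A : (TPt d N' → ℂ) → Matrix Λ Λ ℂ) (Γ : (TPt d N' → ℂ) → (Λ ⊕ C₀ → ℝ) → (Λ → ℂ))
    (χY₀ χcP : (Λ → ℝ) → ℝ) (hχ0 : ∀ B, 0 ≤ χY₀ B) (hχc0 : ∀ B, 0 ≤ χcP B) (Dfam : Finset (TDom d (L * N')))
    -- the last line: the coupling-free functions of the unscaled-field law, at the coupling `s`, clipping radius `ρ`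
    (𝒲 𝒪 : TDom d (L * N') → (Λ → ℝ) → ℂ) {ρ s : ℝ} (hs : 0 < s) (hρ : 0 ≤ ρ)
    {C : Matrix Λ Λ ℝ} (hC : C.PosDef) (Γ₀ : Matrix Λ (Λ ⊕ C₀) ℝ)
    (hAhol : ∀ i j, DifferentiableOn ℂ (fun σ => A σ i j) {σ | ∀ j, σ j ∈ Uσ})
    (hχm : Measurable χY₀) (hχcm : Measurable χcP) (h𝒲m : ∀ Y, Measurable (𝒲 Y)) (h𝒪m : ∀ Y, Measurable (𝒪 Y))
    (hAs : ∀ σ : TPt d N' → ℂ, (∀ j, σ j ∈ Uσ) → (A σ).IsSymm)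
    -- the Γ-operator is linear with kernel G(σ), entrywise holomorphic
    (G : (TPt d N' → ℂ) → Matrix Λ (Λ ⊕ C₀) ℂ)
    (hGhol : ∀ i j, DifferentiableOn ℂ (fun σ => G σ i j) {σ | ∀ j, σ j ∈ Uσ})
    (hlin : ∀ σ : TPt d N' → ℂ, (∀ j, σ j ∈ Uσ) → ∀ X : Λ ⊕ C₀ → ℝ, Γ σ X = G σ *ᵥ fun j => (X j : ℂ))
    -- the (2.22) shape, and the joint (2.20) shape of |W| + |O| on the open per-domain τ-region
    {γ₂ rP : ℝ} (qP : (Λ → ℝ) → ℝ)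
    (h222 : ∀ B, χY₀ B * χcP B ≤ Real.exp (-(γ₂ / 2 * rP ^ 2 * (t.2.card : ℕ)) + γ₂ / 2 * qP B)) (hγ₂ : 0 ≤ γ₂)
    (hqP : ∀ B, qP B ≤ B ⬝ᵥ B)
    -- in place of the joint (2.20) letter: per-domain τ-radii `R(Y)`, the LOCAL letters (L0), (ℓ1), (L4) on the sup-ball of
    -- radius `ρ` with constants depending on the domain, bond supports `S Y`, the PER-BOND multiplicity `m₃`, the box-support
    -- law at the coupling and the `Y`-locality of the potentials
    {R c₀ c₁ c₃ : TDom d (L * N') → ℝ} (hR : ∀ Y ∈ Dfam, 0 ≤ R Y) (hc₃ : ∀ Y ∈ Dfam, 0 ≤ c₃ Y) (hc₁ : ∀ Y ∈ Dfam, 0 ≤ c₁ Y)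
    (hUτR : ∀ Y ∈ Dfam, ∀ z ∈ Uτ Y, ‖z‖ ≤ R Y) (h0 : ∀ Y ∈ Dfam, ‖𝒪 Y 0‖ ≤ c₀ Y)
    (S : TDom d (L * N') → Finset Λ)
    (h1loc : ∀ Y ∈ Dfam, ∀ A, ‖A‖ ≤ ρ → ‖𝒲 Y A‖ ≤ c₃ Y * ‖A‖ * ∑ b ∈ S Y, A b ^ 2)
    (h4 : ∀ Y ∈ Dfam, ∀ A, ‖A‖ ≤ ρ → ‖𝒪 Y A - 𝒪 Y 0‖ ≤ c₁ Y * ‖A‖)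
    {m₃ : ℝ} (hm₃0 : 0 ≤ m₃) (hm₃ : ∀ bd, ∑ Y ∈ Dfam with bd ∈ S Y, R Y * c₃ Y ≤ m₃)
    (S₀ : Set Λ) (hbox : ∀ B, χY₀ B ≠ 0 → ∀ b ∈ S₀, |(s • B) b| ≤ ρ)
    (hloc𝒲 : ∀ Y ∈ Dfam, ∀ A A' : Λ → ℝ, (∀ b ∈ S₀, A b = A' b) → 𝒲 Y A = 𝒲 Y A')
    (hloc𝒪 : ∀ Y ∈ Dfam, ∀ A A' : Λ → ℝ, (∀ b ∈ S₀, A b = A' b) → 𝒪 Y A = 𝒪 Y A')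
    -- bonds located on the torus `UT Nf`
    (locΛ : Λ → UT Nf) (locN : Λ ⊕ C₀ → UT Nf) {m : ℕ}
    (hfibΛ : ∀ x : UT Nf, (Finset.univ.filter fun i => locΛ i = x).card ≤ m)
    (hfibN : ∀ x : UT Nf, (Finset.univ.filter fun j => locN j = x).card ≤ m)
    -- rates and the letters AT b = 1 (+ K_E)
    {kap kap' kap'' θ θE θΓ θC KG KΓ KCs K₀ KE : ℝ} (hkap'' : 0 < kap'') (h1 : kap'' < kap') (h2 : kap' < kap)
    (hθE : 0 ≤ θE) (hθΓ : 0 ≤ θΓ) (hθC : 0 ≤ θC) (hKG : 0 ≤ KG) (hKΓ : 0 ≤ KΓ) (hKCs : 0 ≤ KCs) (hK₀ : 0 ≤ K₀)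
    (hKE : 0 ≤ KE)
    (hG : ∀ σ : TPt d N' → ℂ, (∀ j, σ j ∈ Uσ) →
      ∀ b j, ‖G σ b j‖ ≤ KG * Real.exp (-(kap * tdist1 Nf (locΛ b) (locN j))))
    (hΓ₀ : ∀ b j, ‖Γ₀ b j‖ ≤ KΓ * Real.exp (-(kap * tdist1 Nf (locΛ b) (locN j))))
    (hCs : ∀ σ : TPt d N' → ℂ, (∀ j, σ j ∈ Uσ) →
      ∀ b b', ‖(A σ)⁻¹ b b'‖ ≤ KCs * Real.exp (-(kap * tdist1 Nf (locΛ b) (locΛ b'))))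
    (hC216 : ∀ b b', ‖C b b'‖ ≤ K₀ * Real.exp (-(kap * tdist1 Nf (locΛ b) (locΛ b'))))
    (hCE : ∀ b b', ‖(C⁻¹.map (algebraMap ℝ ℂ)) b b'‖ ≤ KE * Real.exp (-(kap * tdist1 Nf (locΛ b) (locΛ b'))))
    (hdΓ : ∀ σ : TPt d N' → ℂ, (∀ j, σ j ∈ Uσ) →
      ∀ b j, ‖(G σ - Γ₀.map (algebraMap ℝ ℂ)) b j‖ ≤ θΓ * Real.exp (-(kap * tdist1 Nf (locΛ b) (locN j))))
    (hdC : ∀ σ : TPt d N' → ℂ, (∀ j, σ j ∈ Uσ) →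
      ∀ b b', ‖((A σ)⁻¹ - C.map (algebraMap ℝ ℂ)) b b'‖
        ≤ θC * Real.exp (-(kap * tdist1 Nf (locΛ b) (locΛ b'))))
    (hdE : ∀ σ : TPt d N' → ℂ, (∀ j, σ j ∈ Uσ) →
      ∀ b b', ‖(A σ - C⁻¹.map (algebraMap ℝ ℂ)) b b'‖ ≤ θE * Real.exp (-(kap * tdist1 Nf (locΛ b) (locΛ b'))))
    -- the radius of the ball in `b` and the PRIMED letters dominating the §2 transports
    {ρb KG' KCs' θΓ' θC' θE' a' w' : ℝ} (hρb1 : ρb < 1)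
    (hKG' : (1 + ρb) * KG ≤ KG') (hKCs' : ((1 - ρb) ^ 2)⁻¹ * KCs ≤ KCs')
    (hθΓ' : θΓ + ρb * KG ≤ θΓ') (hθC' : θC + ρb * (2 + ρb) * ((1 - ρb) ^ 2)⁻¹ * KCs ≤ θC')
    (hθE' : θE + ρb * (2 + ρb) * (θE + KE) ≤ θE')
    (ha' : (1 + ρb) ^ 2 * (2 * ρ * m₃) ≤ a') (hw' : (1 + ρb) ^ 2 * (∑ Y ∈ Dfam, R Y * (c₀ Y + c₁ Y * ρ)) ≤ w')
    -- the capstone's numeric conditions in the primed letters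
    (hθEle : θE' ≤ θ) (hθΓle : θΓ' ≤ θ)
    (hθR1le : (m * (1 + 2 / (kap - kap')) ^ ν) * (m * (1 + 2 / (kap' - kap'')) ^ ν)
      * (θΓ' * KCs' * KG' + KΓ * θC' * KG' + KΓ * K₀ * θΓ') ≤ θ)
    (hsmallKθ : K₀ * (m * (1 + 2 / kap) ^ ν) * (θ * (m * (1 + 2 / kap'') ^ ν)) < 1)
    {cE g : ℝ} (hc0 : 0 ≤ cE) (hc : ∀ k, hC.1.eigenvalues k ≤ cE)
    (hαc : (2 * (θ * (m * (1 + 2 / kap'') ^ ν)) + (γ₂ + a')) * cE ≤ 1 / 2) (hg : 0 ≤ g)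
    (hΓq : ∀ X : Λ ⊕ C₀ → ℝ, (Γ₀ *ᵥ X) ⬝ᵥ (C *ᵥ (Γ₀ *ᵥ X)) ≤ g * (X ⬝ᵥ X))
    (hsmall : (2 * (θ * (m * (1 + 2 / kap'') ^ ν)) + (γ₂ + a')) * (1 + 2 * cE * g) ≤ 1 / 2)
    -- constant matching, p. 17, in the primed letters: the |P|-rate of the weight and «exp O(1)α₅|Z|»
    {a a₅ : ℝ} (hPa : a ≤ γ₂ * rP ^ 2)
    (hvol : 2 * (K₀ * (m * (1 + 2 / kap) ^ ν) * (θ * (m * (1 + 2 / kap'') ^ ν))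
              * (1 + (1 - K₀ * (m * (1 + 2 / kap) ^ ν) * (θ * (m * (1 + 2 / kap'') ^ ν)))⁻¹) / 2)
          * (Fintype.card Λ : ℝ)
        + w' + (2 * (θ * (m * (1 + 2 / kap'') ^ ν)) + (γ₂ + a')) * cE * (Fintype.card Λ : ℝ)
        + (2 * (θ * (m * (1 + 2 / kap'') ^ ν)) + (γ₂ + a')) * (1 + 2 * cE * g) * (Fintype.card (Λ ⊕ C₀) : ℝ)
        ≤ a₅ * ((Z.1).card : ℝ)) :
    ∀ b ∈ ball (1 : ℂ) ρb,
      ‖term214 r lZ lD (core214 (fun σ => b ^ 2 • A σ) (fun σ X => b • Γ σ X)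
          (F214 t.2.card χY₀ χcP Dfam
            (fun Y B => b ^ 2 * ((((s : ℝ) : ℂ) ^ 2)⁻¹ * 𝒲 Y (s • B)) + 𝒪 Y (s • B)))) 0 0‖ ≤
        weight L M c Z a t * Real.exp (a₅ * ((Z.1).card : ℝ)) := by
  have ha0 : 0 ≤ 2 * ρ * m₃ := by positivity
  have h := h226_torus_windowDilated_of_primitives c hκ₁ hα₆ Z t hpos hhalf hUσ hUτ hUexp hUtau hr hr' hsubτ lZ hlZ lD hlD
    A Γ χY₀ χcP hχ0 hχc0 Dfam (fun Y B => (((s : ℝ) : ℂ) ^ 2)⁻¹ * 𝒲 Y (clip ρ (s • B))) (fun Y B => 𝒪 Y (clip ρ (s • B)))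
    hC Γ₀ hAhol hχm hχcm (measurable_Wclip ρ s h𝒲m) (measurable_Oclip ρ s h𝒪m) hAs G hGhol hlin qP h222 hγ₂ hqP ha0
    (h220U_clip_perBond_split Dfam Uτ S hs hρ hR hc₃ hc₁ hUτR h0 h1loc h4 hm₃)
    locΛ locN hfibΛ hfibN hkap'' h1 h2 hθE hθΓ hθC hKG hKΓ hKCs hK₀ hKE hG hΓ₀ hCs hC216 hCE hdΓ hdC hdE hρb1 hKG' hKCs'
    hθΓ' hθC' hθE' ha' hw' hθEle hθΓle hθR1le hsmallKθ hc0 hc hαc hg hΓq hsmall hPa hvol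
  intro b hb
  rw [← F214_clip_eq_member t.2.card χY₀ χcP Dfam S₀ hbox hloc𝒲 hloc𝒪 b]
  exact h b hb

/-! ## §3. Holomorphy in the member parameter `b` on the ball, from LOCAL growth letters (per-bond rate) -/

open Classical in
/-- **THE WINDOW-DILATED TERM OF THE UNSCALED-FIELD LAW IS HOLOMORPHIC IN `b` ON THE BALL, FROM LOCAL GROWTH LETTERS** (node
N22's (S-last-T′) holomorphy per term) — same data and letters as `h226_torus_windowDilated_of_localGrowth_perBond`; conclusion:
`b ↦ term214(b²A, bΓ, F214 χ χᶜ (b²·s⁻²𝒲(s·) + 𝒪(s·)))` is complex differentiable on `ball 1 ρ_b`.  Proof: the cited engine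
`differentiableOn_term214_torus_windowDilated_of_primitives` on the CLIPPED split pair, then the two families of terms are EQUAL
as functions of `b` (`F214_clip_eq_member`). [cite: Balaban1988RG2Cluster, (2.14)–(2.15) p.15, (2.16)–(2.22) p.16, (2.23)–(2.25) p.17, (2.2)–(2.3) p.12, (1.20) p.6; Balaban1987RG1, §1 p.263, (2.9)–(2.13) pp.266–268] -/
theorem differentiableOn_term214_torus_windowDilated_of_localGrowth_perBond (c : B13.Consts)
    {Uσ : Set ℂ} {Uτ : TDom d (L * N') → Set ℂ} (hUσ : IsOpen Uσ) (hUτ : ∀ Y, IsOpen (Uτ Y))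
    (hUexp : closedBall (0 : ℂ) (Real.exp c.κ₁) ⊆ Uσ)
    {r : ℝ} (hr : 0 < r) (hr' : r ≤ Real.exp c.κ₁ - 1)
    (hsubτ : ∀ Y, ∀ s ∈ Set.uIcc (0 : ℝ) 1, closedBall (s : ℂ) r ⊆ Uτ Y)
    {lZ : List (TPt d N')} (hlZ : lZ.Nodup) {lD : List (TDom d (L * N'))} (hlD : lD.Nodup)
    (A : (TPt d N' → ℂ) → Matrix Λ Λ ℂ) (Γ : (TPt d N' → ℂ) → (Λ ⊕ C₀ → ℝ) → (Λ → ℂ))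
    (cardP : ℕ) (χY₀ χcP : (Λ → ℝ) → ℝ) (hχ0 : ∀ B, 0 ≤ χY₀ B) (hχc0 : ∀ B, 0 ≤ χcP B)
    (Dfam : Finset (TDom d (L * N')))
    -- the last line: the coupling-free functions of the unscaled-field law, at the coupling `s`, clipping radius `ρ`
    (𝒲 𝒪 : TDom d (L * N') → (Λ → ℝ) → ℂ) {ρ s : ℝ} (hs : 0 < s) (hρ : 0 ≤ ρ)
    {C : Matrix Λ Λ ℝ} (hC : C.PosDef) (Γ₀ : Matrix Λ (Λ ⊕ C₀) ℝ)
    (hAhol : ∀ i j, DifferentiableOn ℂ (fun σ => A σ i j) {σ | ∀ j, σ j ∈ Uσ})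
    (hχm : Measurable χY₀) (hχcm : Measurable χcP) (h𝒲m : ∀ Y, Measurable (𝒲 Y)) (h𝒪m : ∀ Y, Measurable (𝒪 Y))
    (hAs : ∀ σ : TPt d N' → ℂ, (∀ j, σ j ∈ Uσ) → (A σ).IsSymm)
    (G : (TPt d N' → ℂ) → Matrix Λ (Λ ⊕ C₀) ℂ)
    (hGhol : ∀ i j, DifferentiableOn ℂ (fun σ => G σ i j) {σ | ∀ j, σ j ∈ Uσ})
    (hlin : ∀ σ : TPt d N' → ℂ, (∀ j, σ j ∈ Uσ) → ∀ X : Λ ⊕ C₀ → ℝ, Γ σ X = G σ *ᵥ fun j => (X j : ℂ))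
    {γ₂ rP : ℝ} (qP : (Λ → ℝ) → ℝ)
    (h222 : ∀ B, χY₀ B * χcP B ≤ Real.exp (-(γ₂ / 2 * rP ^ 2 * cardP) + γ₂ / 2 * qP B)) (hγ₂ : 0 ≤ γ₂)
    (hqP : ∀ B, qP B ≤ B ⬝ᵥ B)
    -- in place of the joint (2.20) letter: per-domain τ-radii `R(Y)`, the LOCAL letters (L0), (ℓ1), (L4) on the sup-ball of
    -- radius `ρ` with constants depending on the domain, bond supports `S Y`, the PER-BOND multiplicity `m₃`, the box-support
    -- law at the coupling and the `Y`-locality of the potentials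
    {R c₀ c₁ c₃ : TDom d (L * N') → ℝ} (hR : ∀ Y ∈ Dfam, 0 ≤ R Y) (hc₃ : ∀ Y ∈ Dfam, 0 ≤ c₃ Y) (hc₁ : ∀ Y ∈ Dfam, 0 ≤ c₁ Y)
    (hUτR : ∀ Y ∈ Dfam, ∀ z ∈ Uτ Y, ‖z‖ ≤ R Y) (h0 : ∀ Y ∈ Dfam, ‖𝒪 Y 0‖ ≤ c₀ Y)
    (S : TDom d (L * N') → Finset Λ)
    (h1loc : ∀ Y ∈ Dfam, ∀ A, ‖A‖ ≤ ρ → ‖𝒲 Y A‖ ≤ c₃ Y * ‖A‖ * ∑ b ∈ S Y, A b ^ 2)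
    (h4 : ∀ Y ∈ Dfam, ∀ A, ‖A‖ ≤ ρ → ‖𝒪 Y A - 𝒪 Y 0‖ ≤ c₁ Y * ‖A‖)
    {m₃ : ℝ} (hm₃0 : 0 ≤ m₃) (hm₃ : ∀ bd, ∑ Y ∈ Dfam with bd ∈ S Y, R Y * c₃ Y ≤ m₃)
    (S₀ : Set Λ) (hbox : ∀ B, χY₀ B ≠ 0 → ∀ b ∈ S₀, |(s • B) b| ≤ ρ)
    (hloc𝒲 : ∀ Y ∈ Dfam, ∀ A A' : Λ → ℝ, (∀ b ∈ S₀, A b = A' b) → 𝒲 Y A = 𝒲 Y A')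
    (hloc𝒪 : ∀ Y ∈ Dfam, ∀ A A' : Λ → ℝ, (∀ b ∈ S₀, A b = A' b) → 𝒪 Y A = 𝒪 Y A')
    (locΛ : Λ → UT Nf) (locN : Λ ⊕ C₀ → UT Nf) {m : ℕ}
    (hfibΛ : ∀ x : UT Nf, (Finset.univ.filter fun i => locΛ i = x).card ≤ m)
    (hfibN : ∀ x : UT Nf, (Finset.univ.filter fun j => locN j = x).card ≤ m)
    {kap kap' kap'' θ θE θΓ θC KG KΓ KCs K₀ KE : ℝ} (hkap'' : 0 < kap'') (h1 : kap'' < kap') (h2 : kap' < kap)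
    (hθE : 0 ≤ θE) (hθΓ : 0 ≤ θΓ) (hθC : 0 ≤ θC) (hKG : 0 ≤ KG) (hKΓ : 0 ≤ KΓ) (hKCs : 0 ≤ KCs) (hK₀ : 0 ≤ K₀)
    (hKE : 0 ≤ KE)
    (hG : ∀ σ : TPt d N' → ℂ, (∀ j, σ j ∈ Uσ) →
      ∀ b j, ‖G σ b j‖ ≤ KG * Real.exp (-(kap * tdist1 Nf (locΛ b) (locN j))))
    (hΓ₀ : ∀ b j, ‖Γ₀ b j‖ ≤ KΓ * Real.exp (-(kap * tdist1 Nf (locΛ b) (locN j))))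
    (hCs : ∀ σ : TPt d N' → ℂ, (∀ j, σ j ∈ Uσ) →
      ∀ b b', ‖(A σ)⁻¹ b b'‖ ≤ KCs * Real.exp (-(kap * tdist1 Nf (locΛ b) (locΛ b'))))
    (hC216 : ∀ b b', ‖C b b'‖ ≤ K₀ * Real.exp (-(kap * tdist1 Nf (locΛ b) (locΛ b'))))
    (hCE : ∀ b b', ‖(C⁻¹.map (algebraMap ℝ ℂ)) b b'‖ ≤ KE * Real.exp (-(kap * tdist1 Nf (locΛ b) (locΛ b'))))
    (hdΓ : ∀ σ : TPt d N' → ℂ, (∀ j, σ j ∈ Uσ) →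
      ∀ b j, ‖(G σ - Γ₀.map (algebraMap ℝ ℂ)) b j‖ ≤ θΓ * Real.exp (-(kap * tdist1 Nf (locΛ b) (locN j))))
    (hdC : ∀ σ : TPt d N' → ℂ, (∀ j, σ j ∈ Uσ) →
      ∀ b b', ‖((A σ)⁻¹ - C.map (algebraMap ℝ ℂ)) b b'‖
        ≤ θC * Real.exp (-(kap * tdist1 Nf (locΛ b) (locΛ b'))))
    (hdE : ∀ σ : TPt d N' → ℂ, (∀ j, σ j ∈ Uσ) →
      ∀ b b', ‖(A σ - C⁻¹.map (algebraMap ℝ ℂ)) b b'‖ ≤ θE * Real.exp (-(kap * tdist1 Nf (locΛ b) (locΛ b'))))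
    {ρb KG' KCs' θΓ' θC' θE' a' w' : ℝ} (hρb1 : ρb < 1)
    (hKG' : (1 + ρb) * KG ≤ KG') (hKCs' : ((1 - ρb) ^ 2)⁻¹ * KCs ≤ KCs')
    (hθΓ' : θΓ + ρb * KG ≤ θΓ') (hθC' : θC + ρb * (2 + ρb) * ((1 - ρb) ^ 2)⁻¹ * KCs ≤ θC')
    (hθE' : θE + ρb * (2 + ρb) * (θE + KE) ≤ θE')
    (ha' : (1 + ρb) ^ 2 * (2 * ρ * m₃) ≤ a') (hw' : (1 + ρb) ^ 2 * (∑ Y ∈ Dfam, R Y * (c₀ Y + c₁ Y * ρ)) ≤ w')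
    (hθEle : θE' ≤ θ) (hθΓle : θΓ' ≤ θ)
    (hθR1le : (m * (1 + 2 / (kap - kap')) ^ ν) * (m * (1 + 2 / (kap' - kap'')) ^ ν)
      * (θΓ' * KCs' * KG' + KΓ * θC' * KG' + KΓ * K₀ * θΓ') ≤ θ)
    (hsmallKθ : K₀ * (m * (1 + 2 / kap) ^ ν) * (θ * (m * (1 + 2 / kap'') ^ ν)) < 1)
    {cE g : ℝ} (hc0 : 0 ≤ cE) (hc : ∀ k, hC.1.eigenvalues k ≤ cE)
    (hαc : (2 * (θ * (m * (1 + 2 / kap'') ^ ν)) + (γ₂ + a')) * cE ≤ 1 / 2)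
    (hΓq : ∀ X : Λ ⊕ C₀ → ℝ, (Γ₀ *ᵥ X) ⬝ᵥ (C *ᵥ (Γ₀ *ᵥ X)) ≤ g * (X ⬝ᵥ X))
    (hsmall : (2 * (θ * (m * (1 + 2 / kap'') ^ ν)) + (γ₂ + a')) * (1 + 2 * cE * g) ≤ 1 / 2) :
    DifferentiableOn ℂ (fun b : ℂ => term214 r lZ lD (core214 (fun σ => b ^ 2 • A σ) (fun σ X => b • Γ σ X)
      (F214 cardP χY₀ χcP Dfam
        (fun Y B => b ^ 2 * ((((s : ℝ) : ℂ) ^ 2)⁻¹ * 𝒲 Y (s • B)) + 𝒪 Y (s • B)))) 0 0) (ball (1 : ℂ) ρb) := by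
  have ha0 : 0 ≤ 2 * ρ * m₃ := by positivity
  have h := differentiableOn_term214_torus_windowDilated_of_primitives c hUσ hUτ hUexp hr hr' hsubτ hlZ hlD A Γ cardP χY₀
    χcP hχ0 hχc0 Dfam (fun Y B => (((s : ℝ) : ℂ) ^ 2)⁻¹ * 𝒲 Y (clip ρ (s • B))) (fun Y B => 𝒪 Y (clip ρ (s • B))) hC Γ₀
    hAhol hχm hχcm (measurable_Wclip ρ s h𝒲m) (measurable_Oclip ρ s h𝒪m) hAs G hGhol hlin qP h222 hγ₂ hqP ha0
    (h220U_clip_perBond_split Dfam Uτ S hs hρ hR hc₃ hc₁ hUτR h0 h1loc h4 hm₃)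
    locΛ locN hfibΛ hfibN hkap'' h1 h2 hθE hθΓ hθC hKG hKΓ hKCs hK₀ hKE hG hΓ₀ hCs hC216 hCE hdΓ hdC hdE hρb1 hKG' hKCs'
    hθΓ' hθC' hθE' ha' hw' hθEle hθΓle hθR1le hsmallKθ hc0 hc hαc hΓq hsmall
  have e : (fun b : ℂ => term214 r lZ lD (core214 (fun σ => b ^ 2 • A σ) (fun σ X => b • Γ σ X)
              (F214 cardP χY₀ χcP Dfam
                (fun Y B => b ^ 2 * ((((s : ℝ) : ℂ) ^ 2)⁻¹ * 𝒲 Y (s • B)) + 𝒪 Y (s • B)))) 0 0)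
      = (fun b : ℂ => term214 r lZ lD (core214 (fun σ => b ^ 2 • A σ) (fun σ X => b • Γ σ X)
              (F214 cardP χY₀ χcP Dfam
                (fun Y B => b ^ 2 * ((((s : ℝ) : ℂ) ^ 2)⁻¹ * 𝒲 Y (clip ρ (s • B))) + 𝒪 Y (clip ρ (s • B))))) 0 0) := by
    funext b
    rw [F214_clip_eq_member cardP χY₀ χcP Dfam S₀ hbox hloc𝒲 hloc𝒪 b]
  rw [e]
  exact h

end Torus

/-! ## §4 (v1.1, append-only). The history direction: holomorphy in an external parameter entering the older terms only,
at a fixed member `b`, from LOCAL growth letters (per-bond rate) -/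

section History

variable {d L N' : ℕ} [NeZero L] [NeZero N']
variable {ν : ℕ} {Nf : Fin ν → ℕ} [∀ i, NeZero (Nf i)]
variable {Λ : Type} [Fintype Λ] [DecidableEq Λ] {C₀ : Type} [Fintype C₀] [DecidableEq C₀]
variable {P : Type*} [NormedAddCommGroup P] [NormedSpace ℂ P] {Wp : Set P}

open Classical in
/-- **THE WINDOW-DILATED TERM OF THE UNSCALED-FIELD LAW AT A FIXED MEMBER `b` IS HOLOMORPHIC IN ANY EXTERNAL PARAMETER ENTERING
THE OLDER TERMS ONLY, FROM LOCAL GROWTH LETTERS** — node N22's (S-226-T′) history direction per term: same data and letters at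
`b = 1` as `h226_torus_windowDilated_of_localGrowth_perBond`, the older terms `𝒪_p` now parametrised by `p` of an open set `Wp`
of a complex normed space (`𝒪_p(Y,·)` measurable, `p ↦ 𝒪_p(Y,A)` holomorphic on `Wp`, the LOCAL letters (L0), (L4) and the
`Y`-locality uniform in `p ∈ Wp`), and ONE member `b` of the ball; conclusion: `p ↦ term214(b²A, bΓ, F214 χ χᶜ (b²·s⁻²𝒲(s·) +
𝒪_p(s·)))` is complex differentiable on `Wp`.  Proof: `B13Term214WindowDilated.differentiableOn_term214_torus_windowDilated_history_of_primitives`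
on the CLIPPED split pair (`p ↦ 𝒪_p(Y, clip ρ(sB))` is holomorphic with `𝒪_p(Y, ·)`), then `DifferentiableOn.congr` through
`F214_clip_eq_member` at each `p ∈ Wp`. [cite: Balaban1988RG2Cluster, (2.14)–(2.15) p.15, (2.16)–(2.22) p.16, (2.23)–(2.25) p.17, (1.41) p.11, (2.2)–(2.3) p.12, (1.20) p.6; Balaban1987RG1, (2.9)–(2.13) pp.266–268] -/
theorem differentiableOn_term214_torus_windowDilated_history_of_localGrowth_perBond (c : B13.Consts)
    (hWp : IsOpen Wp)
    {Uσ : Set ℂ} {Uτ : TDom d (L * N') → Set ℂ} (hUσ : IsOpen Uσ) (hUτ : ∀ Y, IsOpen (Uτ Y))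
    (hUexp : closedBall (0 : ℂ) (Real.exp c.κ₁) ⊆ Uσ)
    {r : ℝ} (hr : 0 < r) (hr' : r ≤ Real.exp c.κ₁ - 1)
    (hsubτ : ∀ Y, ∀ s ∈ Set.uIcc (0 : ℝ) 1, closedBall (s : ℂ) r ⊆ Uτ Y)
    {lZ : List (TPt d N')} (hlZ : lZ.Nodup) {lD : List (TDom d (L * N'))} (hlD : lD.Nodup)
    (A : (TPt d N' → ℂ) → Matrix Λ Λ ℂ) (Γ : (TPt d N' → ℂ) → (Λ ⊕ C₀ → ℝ) → (Λ → ℂ))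
    (cardP : ℕ) (χY₀ χcP : (Λ → ℝ) → ℝ) (hχ0 : ∀ B, 0 ≤ χY₀ B) (hχc0 : ∀ B, 0 ≤ χcP B)
    (Dfam : Finset (TDom d (L * N')))
    -- the last line: the coupling-free Wilson part `𝒲` and the older terms `𝒪_p` parametrised by `p ∈ Wp`, at the coupling `s`,
    -- clipping radius `ρ`
    (𝒲 : TDom d (L * N') → (Λ → ℝ) → ℂ) (𝒪 : P → TDom d (L * N') → (Λ → ℝ) → ℂ) {ρ s : ℝ} (hs : 0 < s) (hρ : 0 ≤ ρ)
    {C : Matrix Λ Λ ℝ} (hC : C.PosDef) (Γ₀ : Matrix Λ (Λ ⊕ C₀) ℝ)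
    (hAhol : ∀ i j, DifferentiableOn ℂ (fun σ => A σ i j) {σ | ∀ j, σ j ∈ Uσ})
    (hχm : Measurable χY₀) (hχcm : Measurable χcP) (h𝒲m : ∀ Y, Measurable (𝒲 Y))
    (h𝒪m : ∀ p ∈ Wp, ∀ Y, Measurable (𝒪 p Y)) (h𝒪d : ∀ Y A, DifferentiableOn ℂ (fun p => 𝒪 p Y A) Wp)
    (hAs : ∀ σ : TPt d N' → ℂ, (∀ j, σ j ∈ Uσ) → (A σ).IsSymm)
    (G : (TPt d N' → ℂ) → Matrix Λ (Λ ⊕ C₀) ℂ)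
    (hGhol : ∀ i j, DifferentiableOn ℂ (fun σ => G σ i j) {σ | ∀ j, σ j ∈ Uσ})
    (hlin : ∀ σ : TPt d N' → ℂ, (∀ j, σ j ∈ Uσ) → ∀ X : Λ ⊕ C₀ → ℝ, Γ σ X = G σ *ᵥ fun j => (X j : ℂ))
    {γ₂ rP : ℝ} (qP : (Λ → ℝ) → ℝ)
    (h222 : ∀ B, χY₀ B * χcP B ≤ Real.exp (-(γ₂ / 2 * rP ^ 2 * cardP) + γ₂ / 2 * qP B)) (hγ₂ : 0 ≤ γ₂)
    (hqP : ∀ B, qP B ≤ B ⬝ᵥ B)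
    -- in place of the joint (2.20) letter uniform in `p`: per-domain τ-radii `R(Y)`, the LOCAL letters (L0), (L4) for `𝒪_p`
    -- uniformly in `p ∈ Wp` and (ℓ1) for `𝒲` on the sup-ball of radius `ρ`, bond supports `S Y`, the PER-BOND multiplicity `m₃`,
    -- the box-support law at the coupling and the `Y`-locality of the potentials
    {R c₀ c₁ c₃ : TDom d (L * N') → ℝ} (hR : ∀ Y ∈ Dfam, 0 ≤ R Y) (hc₃ : ∀ Y ∈ Dfam, 0 ≤ c₃ Y) (hc₁ : ∀ Y ∈ Dfam, 0 ≤ c₁ Y)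
    (hUτR : ∀ Y ∈ Dfam, ∀ z ∈ Uτ Y, ‖z‖ ≤ R Y) (h0 : ∀ p ∈ Wp, ∀ Y ∈ Dfam, ‖𝒪 p Y 0‖ ≤ c₀ Y)
    (S : TDom d (L * N') → Finset Λ)
    (h1loc : ∀ Y ∈ Dfam, ∀ A, ‖A‖ ≤ ρ → ‖𝒲 Y A‖ ≤ c₃ Y * ‖A‖ * ∑ b ∈ S Y, A b ^ 2)
    (h4 : ∀ p ∈ Wp, ∀ Y ∈ Dfam, ∀ A, ‖A‖ ≤ ρ → ‖𝒪 p Y A - 𝒪 p Y 0‖ ≤ c₁ Y * ‖A‖)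
    {m₃ : ℝ} (hm₃0 : 0 ≤ m₃) (hm₃ : ∀ bd, ∑ Y ∈ Dfam with bd ∈ S Y, R Y * c₃ Y ≤ m₃)
    (S₀ : Set Λ) (hbox : ∀ B, χY₀ B ≠ 0 → ∀ b ∈ S₀, |(s • B) b| ≤ ρ)
    (hloc𝒲 : ∀ Y ∈ Dfam, ∀ A A' : Λ → ℝ, (∀ b ∈ S₀, A b = A' b) → 𝒲 Y A = 𝒲 Y A')
    (hloc𝒪 : ∀ p ∈ Wp, ∀ Y ∈ Dfam, ∀ A A' : Λ → ℝ, (∀ b ∈ S₀, A b = A' b) → 𝒪 p Y A = 𝒪 p Y A')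
    (locΛ : Λ → UT Nf) (locN : Λ ⊕ C₀ → UT Nf) {m : ℕ}
    (hfibΛ : ∀ x : UT Nf, (Finset.univ.filter fun i => locΛ i = x).card ≤ m)
    (hfibN : ∀ x : UT Nf, (Finset.univ.filter fun j => locN j = x).card ≤ m)
    {kap kap' kap'' θ θE θΓ θC KG KΓ KCs K₀ KE : ℝ} (hkap'' : 0 < kap'') (h1 : kap'' < kap') (h2 : kap' < kap)
    (hθE : 0 ≤ θE) (hθΓ : 0 ≤ θΓ) (hθC : 0 ≤ θC) (hKG : 0 ≤ KG) (hKΓ : 0 ≤ KΓ) (hKCs : 0 ≤ KCs) (hK₀ : 0 ≤ K₀)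
    (hKE : 0 ≤ KE)
    (hG : ∀ σ : TPt d N' → ℂ, (∀ j, σ j ∈ Uσ) →
      ∀ b j, ‖G σ b j‖ ≤ KG * Real.exp (-(kap * tdist1 Nf (locΛ b) (locN j))))
    (hΓ₀ : ∀ b j, ‖Γ₀ b j‖ ≤ KΓ * Real.exp (-(kap * tdist1 Nf (locΛ b) (locN j))))
    (hCs : ∀ σ : TPt d N' → ℂ, (∀ j, σ j ∈ Uσ) →
      ∀ b b', ‖(A σ)⁻¹ b b'‖ ≤ KCs * Real.exp (-(kap * tdist1 Nf (locΛ b) (locΛ b'))))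
    (hC216 : ∀ b b', ‖C b b'‖ ≤ K₀ * Real.exp (-(kap * tdist1 Nf (locΛ b) (locΛ b'))))
    (hCE : ∀ b b', ‖(C⁻¹.map (algebraMap ℝ ℂ)) b b'‖ ≤ KE * Real.exp (-(kap * tdist1 Nf (locΛ b) (locΛ b'))))
    (hdΓ : ∀ σ : TPt d N' → ℂ, (∀ j, σ j ∈ Uσ) →
      ∀ b j, ‖(G σ - Γ₀.map (algebraMap ℝ ℂ)) b j‖ ≤ θΓ * Real.exp (-(kap * tdist1 Nf (locΛ b) (locN j))))
    (hdC : ∀ σ : TPt d N' → ℂ, (∀ j, σ j ∈ Uσ) →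
      ∀ b b', ‖((A σ)⁻¹ - C.map (algebraMap ℝ ℂ)) b b'‖
        ≤ θC * Real.exp (-(kap * tdist1 Nf (locΛ b) (locΛ b'))))
    (hdE : ∀ σ : TPt d N' → ℂ, (∀ j, σ j ∈ Uσ) →
      ∀ b b', ‖(A σ - C⁻¹.map (algebraMap ℝ ℂ)) b b'‖ ≤ θE * Real.exp (-(kap * tdist1 Nf (locΛ b) (locΛ b'))))
    {ρb KG' KCs' θΓ' θC' θE' a' w' : ℝ} (hρb1 : ρb < 1)
    (hKG' : (1 + ρb) * KG ≤ KG') (hKCs' : ((1 - ρb) ^ 2)⁻¹ * KCs ≤ KCs')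
    (hθΓ' : θΓ + ρb * KG ≤ θΓ') (hθC' : θC + ρb * (2 + ρb) * ((1 - ρb) ^ 2)⁻¹ * KCs ≤ θC')
    (hθE' : θE + ρb * (2 + ρb) * (θE + KE) ≤ θE')
    (ha' : (1 + ρb) ^ 2 * (2 * ρ * m₃) ≤ a') (hw' : (1 + ρb) ^ 2 * (∑ Y ∈ Dfam, R Y * (c₀ Y + c₁ Y * ρ)) ≤ w')
    (hθEle : θE' ≤ θ) (hθΓle : θΓ' ≤ θ)
    (hθR1le : (m * (1 + 2 / (kap - kap')) ^ ν) * (m * (1 + 2 / (kap' - kap'')) ^ ν)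
      * (θΓ' * KCs' * KG' + KΓ * θC' * KG' + KΓ * K₀ * θΓ') ≤ θ)
    (hsmallKθ : K₀ * (m * (1 + 2 / kap) ^ ν) * (θ * (m * (1 + 2 / kap'') ^ ν)) < 1)
    {cE g : ℝ} (hc0 : 0 ≤ cE) (hc : ∀ k, hC.1.eigenvalues k ≤ cE)
    (hαc : (2 * (θ * (m * (1 + 2 / kap'') ^ ν)) + (γ₂ + a')) * cE ≤ 1 / 2)
    (hΓq : ∀ X : Λ ⊕ C₀ → ℝ, (Γ₀ *ᵥ X) ⬝ᵥ (C *ᵥ (Γ₀ *ᵥ X)) ≤ g * (X ⬝ᵥ X))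
    (hsmall : (2 * (θ * (m * (1 + 2 / kap'') ^ ν)) + (γ₂ + a')) * (1 + 2 * cE * g) ≤ 1 / 2)
    {b : ℂ} (hb : b ∈ ball (1 : ℂ) ρb) :
    DifferentiableOn ℂ (fun p : P => term214 r lZ lD (core214 (fun σ => b ^ 2 • A σ) (fun σ X => b • Γ σ X)
      (F214 cardP χY₀ χcP Dfam
        (fun Y B => b ^ 2 * ((((s : ℝ) : ℂ) ^ 2)⁻¹ * 𝒲 Y (s • B)) + 𝒪 p Y (s • B)))) 0 0) Wp := by
  have ha0 : 0 ≤ 2 * ρ * m₃ := by positivity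
  have h := differentiableOn_term214_torus_windowDilated_history_of_primitives c hWp hUσ hUτ hUexp hr hr' hsubτ hlZ hlD A Γ
    cardP χY₀ χcP hχ0 hχc0 Dfam (fun Y B => (((s : ℝ) : ℂ) ^ 2)⁻¹ * 𝒲 Y (clip ρ (s • B)))
    (fun p Y B => 𝒪 p Y (clip ρ (s • B))) hC Γ₀ hAhol hχm hχcm (measurable_Wclip ρ s h𝒲m)
    (fun p hp => measurable_Oclip ρ s (h𝒪m p hp)) (fun Y B => h𝒪d Y (clip ρ (s • B))) hAs G hGhol hlin qP h222 hγ₂ hqP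
    ha0 (fun p hp => h220U_clip_perBond_split Dfam Uτ S hs hρ hR hc₃ hc₁ hUτR (h0 p hp) h1loc (h4 p hp) hm₃)
    locΛ locN hfibΛ hfibN hkap'' h1 h2 hθE hθΓ hθC hKG hKΓ hKCs hK₀ hKE hG hΓ₀ hCs hC216 hCE hdΓ hdC hdE hρb1 hKG' hKCs'
    hθΓ' hθC' hθE' ha' hw' hθEle hθΓle hθR1le hsmallKθ hc0 hc hαc hΓq hsmall hb
  refine h.congr fun p hp => ?_
  rw [F214_clip_eq_member cardP χY₀ χcP Dfam S₀ hbox hloc𝒲 (hloc𝒪 p hp) b]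

end History

/-! ## §5 (v1.2, append-only). The large-field members (`P ≠ ∅`) of the unscaled-field law: the (2.22) surplus in front of
the (2.26) weight at a smaller radius, from LOCAL growth letters (per-bond rate) -/

section LargeField

variable {d L N' : ℕ} [NeZero L] [NeZero N'] {M : ℕ}
variable {ν : ℕ} {Nf : Fin ν → ℕ} [∀ i, NeZero (Nf i)]
variable {Λ : Type} [Fintype Λ] [DecidableEq Λ] {C₀ : Type} [Fintype C₀] [DecidableEq C₀]

open B13Bound226BoxTail (h226_torus_windowDilated_largeField_of_primitives)

open Classical in
/-- **THE LARGE-FIELD MEMBERS (`P ≠ ∅`) OF THE WINDOW-DILATED FAMILY OF THE UNSCALED-FIELD LAW ARE SMALL, FROM LOCAL GROWTH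
LETTERS**: the (2.22) surplus `e^{−½γ₂(r_P² − r₁²)}` comes out in front of the (2.26) weight at the smaller radius `r₁`, for EVERY
member `b` of the ball and the law's member family `fun Y B => b^2 * ((s:ℂ)^2)⁻¹ * 𝒲 Y (s • B)) + 𝒪 Y (s • B)` (node N22's
(S-vertex-T′) for the terms with `P ≠ ∅`, whose centre is `0` — the one member of the local-growth road whose only Lemma-2-type
input in `B13Bound226BoxTail.h226_torus_windowDilated_largeField_of_primitives` was the JOINT (2.20) letter of the UNCLIPPED pair,
which has no `t`-uniform inhabitant under the unscaled-field law).  Data and letters of that theorem VERBATIM (kernels, boxes with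
(2.22) at radius `r_P`, `|P| ≥ 1`, a smaller radius `r₁` with `r₁² ≤ r_P²`, references, the (L17a)∕(L16a) letters, `K_E`, `ρ_b < 1`,
primed letters, numeric conditions, `hPa : a ≤ γ₂r₁²`, `hvol`), its last-line block `W O hWm hOm ha0 h220U` REPLACED by the
local-growth block of `h226_torus_windowDilated_of_localGrowth_perBond` verbatim: the coupling-free `𝒲, 𝒪` (measurable in the
field) at the coupling `s > 0` and clipping radius `ρ ≥ 0`, per-domain τ-radii `R(Y)`, the LOCAL letters (L0) `‖𝒪(Y,0)‖ ≤ c₀(Y)`,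
(ℓ1) `‖𝒲(Y,A)‖ ≤ c₃(Y)‖A‖Σ_{b∈S Y}A_b²`, (L4) `‖𝒪(Y,A) − 𝒪(Y,0)‖ ≤ c₁(Y)‖A‖` on the sup-ball `‖A‖ ≤ ρ`, bond supports `S Y`,
the PER-BOND multiplicity `m₃`, the box-support law at the coupling and the `Y`-locality of the potentials; primed (2.20) letters
`a′ ≥ (1+ρ_b)²·2ρm₃`, `w′ ≥ (1+ρ_b)²·Σ_Y R(Y)(c₀(Y) + c₁(Y)ρ)`.  Conclusion: for every `b` of the ball,
`‖(2.14)_b‖ ≤ e^{−½γ₂(r_P² − r₁²)}·(weight L M c Z a t·exp(a₅|Z|))`.  Proof (node N22's seat's three-line recipe, ASK-d15): the cited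
engine on the CLIPPED split pair (§1 `h220U_clip_perBond_split`, `measurable_Wclip∕Oclip`), then `F214_clip_eq_member`.  No new
engine, no estimate new in kind.
[cite: Balaban1988RG2Cluster, (2.14)–(2.15) p.15, (2.16)–(2.22) p.16, (2.23)–(2.26) p.17, (2.2)–(2.3) p.12, (1.42) p.11, (1.20) p.6; Balaban1987RG1, (2.9)–(2.13) pp.266–268] -/
theorem h226_torus_windowDilated_largeField_of_localGrowth_perBond (c : B13.Consts) (hκ₁ : 1 ≤ c.κ₁) (hα₆ : c.α₆ ≠ 0)
    (Z : TDom d N') (t : Finset (TDom d (L * N')) × Finset (TBond d M (L * N')))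
    (hpos : ∀ Y : TDom d (L * N'), 0 < invTau c ((tsys d (L * N')).dj Y))
    (hhalf : ∀ Y : TDom d (L * N'), invTau c ((tsys d (L * N')).dj Y) ≤ 1 / 2)
    {Uσ : Set ℂ} {Uτ : TDom d (L * N') → Set ℂ} (hUσ : IsOpen Uσ) (hUτ : ∀ Y, IsOpen (Uτ Y))
    (hUexp : closedBall (0 : ℂ) (Real.exp c.κ₁) ⊆ Uσ)
    (hUtau : ∀ Y : TDom d (L * N'), closedBall (0 : ℂ) ((invTau c ((tsys d (L * N')).dj Y))⁻¹) ⊆ Uτ Y)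
    {r : ℝ} (hr : 0 < r) (hr' : r ≤ Real.exp c.κ₁ - 1)
    (hsubτ : ∀ Y, ∀ s ∈ Set.uIcc (0 : ℝ) 1, closedBall (s : ℂ) r ⊆ Uτ Y)
    -- the parameter lists of the term: σ over the blocks of Z∖Z′₀, τ over 𝐃
    (lZ : List (TPt d N')) (hlZ : lZ.Nodup ∧ lZ.toFinset = Z.1 \ tclosure L N' (Z0 M t))
    (lD : List (TDom d (L * N'))) (hlD : lD.Nodup ∧ lD.toFinset = t.1)
    -- the (2.14)-data of the term AT THE REAL COUPLING (b = 1)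
    (A : (TPt d N' → ℂ) → Matrix Λ Λ ℂ) (Γ : (TPt d N' → ℂ) → (Λ ⊕ C₀ → ℝ) → (Λ → ℂ))
    (χY₀ χcP : (Λ → ℝ) → ℝ) (hχ0 : ∀ B, 0 ≤ χY₀ B) (hχc0 : ∀ B, 0 ≤ χcP B) (Dfam : Finset (TDom d (L * N')))
    -- the last line: the coupling-free functions of the unscaled-field law, at the coupling `s`, clipping radius `ρ`
    (𝒲 𝒪 : TDom d (L * N') → (Λ → ℝ) → ℂ) {ρ s : ℝ} (hs : 0 < s) (hρ : 0 ≤ ρ)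
    {C : Matrix Λ Λ ℝ} (hC : C.PosDef) (Γ₀ : Matrix Λ (Λ ⊕ C₀) ℝ)
    (hAhol : ∀ i j, DifferentiableOn ℂ (fun σ => A σ i j) {σ | ∀ j, σ j ∈ Uσ})
    (hχm : Measurable χY₀) (hχcm : Measurable χcP) (h𝒲m : ∀ Y, Measurable (𝒲 Y)) (h𝒪m : ∀ Y, Measurable (𝒪 Y))
    (hAs : ∀ σ : TPt d N' → ℂ, (∀ j, σ j ∈ Uσ) → (A σ).IsSymm)
    -- the Γ-operator is linear with kernel G(σ), entrywise holomorphic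
    (G : (TPt d N' → ℂ) → Matrix Λ (Λ ⊕ C₀) ℂ)
    (hGhol : ∀ i j, DifferentiableOn ℂ (fun σ => G σ i j) {σ | ∀ j, σ j ∈ Uσ})
    (hlin : ∀ σ : TPt d N' → ℂ, (∀ j, σ j ∈ Uσ) → ∀ X : Λ ⊕ C₀ → ℝ, Γ σ X = G σ *ᵥ fun j => (X j : ℂ))
    -- (2.22) at radius r_P with |P| ≥ 1, and a smaller radius r₁
    {γ₂ rP r₁ : ℝ} (qP : (Λ → ℝ) → ℝ)
    (h222 : ∀ B, χY₀ B * χcP B ≤ Real.exp (-(γ₂ / 2 * rP ^ 2 * (t.2.card : ℕ)) + γ₂ / 2 * qP B)) (hγ₂ : 0 ≤ γ₂)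
    (hqP : ∀ B, qP B ≤ B ⬝ᵥ B) (hr₁ : r₁ ^ 2 ≤ rP ^ 2) (hP1 : 1 ≤ t.2.card)
    -- in place of the joint (2.20) letter: per-domain τ-radii `R(Y)`, the LOCAL letters (L0), (ℓ1), (L4) on the sup-ball of
    -- radius `ρ` with constants depending on the domain, bond supports `S Y`, the PER-BOND multiplicity `m₃`, the box-support
    -- law at the coupling and the `Y`-locality of the potentials
    {R c₀ c₁ c₃ : TDom d (L * N') → ℝ} (hR : ∀ Y ∈ Dfam, 0 ≤ R Y) (hc₃ : ∀ Y ∈ Dfam, 0 ≤ c₃ Y) (hc₁ : ∀ Y ∈ Dfam, 0 ≤ c₁ Y)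
    (hUτR : ∀ Y ∈ Dfam, ∀ z ∈ Uτ Y, ‖z‖ ≤ R Y) (h0 : ∀ Y ∈ Dfam, ‖𝒪 Y 0‖ ≤ c₀ Y)
    (S : TDom d (L * N') → Finset Λ)
    (h1loc : ∀ Y ∈ Dfam, ∀ A, ‖A‖ ≤ ρ → ‖𝒲 Y A‖ ≤ c₃ Y * ‖A‖ * ∑ b ∈ S Y, A b ^ 2)
    (h4 : ∀ Y ∈ Dfam, ∀ A, ‖A‖ ≤ ρ → ‖𝒪 Y A - 𝒪 Y 0‖ ≤ c₁ Y * ‖A‖)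
    {m₃ : ℝ} (hm₃0 : 0 ≤ m₃) (hm₃ : ∀ bd, ∑ Y ∈ Dfam with bd ∈ S Y, R Y * c₃ Y ≤ m₃)
    (S₀ : Set Λ) (hbox : ∀ B, χY₀ B ≠ 0 → ∀ b ∈ S₀, |(s • B) b| ≤ ρ)
    (hloc𝒲 : ∀ Y ∈ Dfam, ∀ A A' : Λ → ℝ, (∀ b ∈ S₀, A b = A' b) → 𝒲 Y A = 𝒲 Y A')
    (hloc𝒪 : ∀ Y ∈ Dfam, ∀ A A' : Λ → ℝ, (∀ b ∈ S₀, A b = A' b) → 𝒪 Y A = 𝒪 Y A')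
    -- bonds located on the torus `UT Nf`
    (locΛ : Λ → UT Nf) (locN : Λ ⊕ C₀ → UT Nf) {m : ℕ}
    (hfibΛ : ∀ x : UT Nf, (Finset.univ.filter fun i => locΛ i = x).card ≤ m)
    (hfibN : ∀ x : UT Nf, (Finset.univ.filter fun j => locN j = x).card ≤ m)
    -- rates and the letters AT b = 1 (+ K_E)
    {kap kap' kap'' θ θE θΓ θC KG KΓ KCs K₀ KE : ℝ} (hkap'' : 0 < kap'') (h1 : kap'' < kap') (h2 : kap' < kap)
    (hθE : 0 ≤ θE) (hθΓ : 0 ≤ θΓ) (hθC : 0 ≤ θC) (hKG : 0 ≤ KG) (hKΓ : 0 ≤ KΓ) (hKCs : 0 ≤ KCs) (hK₀ : 0 ≤ K₀)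
    (hKE : 0 ≤ KE)
    (hG : ∀ σ : TPt d N' → ℂ, (∀ j, σ j ∈ Uσ) →
      ∀ b j, ‖G σ b j‖ ≤ KG * Real.exp (-(kap * tdist1 Nf (locΛ b) (locN j))))
    (hΓ₀ : ∀ b j, ‖Γ₀ b j‖ ≤ KΓ * Real.exp (-(kap * tdist1 Nf (locΛ b) (locN j))))
    (hCs : ∀ σ : TPt d N' → ℂ, (∀ j, σ j ∈ Uσ) →
      ∀ b b', ‖(A σ)⁻¹ b b'‖ ≤ KCs * Real.exp (-(kap * tdist1 Nf (locΛ b) (locΛ b'))))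
    (hC216 : ∀ b b', ‖C b b'‖ ≤ K₀ * Real.exp (-(kap * tdist1 Nf (locΛ b) (locΛ b'))))
    (hCE : ∀ b b', ‖(C⁻¹.map (algebraMap ℝ ℂ)) b b'‖ ≤ KE * Real.exp (-(kap * tdist1 Nf (locΛ b) (locΛ b'))))
    (hdΓ : ∀ σ : TPt d N' → ℂ, (∀ j, σ j ∈ Uσ) →
      ∀ b j, ‖(G σ - Γ₀.map (algebraMap ℝ ℂ)) b j‖ ≤ θΓ * Real.exp (-(kap * tdist1 Nf (locΛ b) (locN j))))
    (hdC : ∀ σ : TPt d N' → ℂ, (∀ j, σ j ∈ Uσ) →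
      ∀ b b', ‖((A σ)⁻¹ - C.map (algebraMap ℝ ℂ)) b b'‖
        ≤ θC * Real.exp (-(kap * tdist1 Nf (locΛ b) (locΛ b'))))
    (hdE : ∀ σ : TPt d N' → ℂ, (∀ j, σ j ∈ Uσ) →
      ∀ b b', ‖(A σ - C⁻¹.map (algebraMap ℝ ℂ)) b b'‖ ≤ θE * Real.exp (-(kap * tdist1 Nf (locΛ b) (locΛ b'))))
    -- the radius of the ball in `b` and the PRIMED letters dominating the §2 transports
    {ρb KG' KCs' θΓ' θC' θE' a' w' : ℝ} (hρb1 : ρb < 1)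
    (hKG' : (1 + ρb) * KG ≤ KG') (hKCs' : ((1 - ρb) ^ 2)⁻¹ * KCs ≤ KCs')
    (hθΓ' : θΓ + ρb * KG ≤ θΓ') (hθC' : θC + ρb * (2 + ρb) * ((1 - ρb) ^ 2)⁻¹ * KCs ≤ θC')
    (hθE' : θE + ρb * (2 + ρb) * (θE + KE) ≤ θE')
    (ha' : (1 + ρb) ^ 2 * (2 * ρ * m₃) ≤ a') (hw' : (1 + ρb) ^ 2 * (∑ Y ∈ Dfam, R Y * (c₀ Y + c₁ Y * ρ)) ≤ w')
    -- the capstone's numeric conditions in the primed letters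
    (hθEle : θE' ≤ θ) (hθΓle : θΓ' ≤ θ)
    (hθR1le : (m * (1 + 2 / (kap - kap')) ^ ν) * (m * (1 + 2 / (kap' - kap'')) ^ ν)
      * (θΓ' * KCs' * KG' + KΓ * θC' * KG' + KΓ * K₀ * θΓ') ≤ θ)
    (hsmallKθ : K₀ * (m * (1 + 2 / kap) ^ ν) * (θ * (m * (1 + 2 / kap'') ^ ν)) < 1)
    {cE g : ℝ} (hc0 : 0 ≤ cE) (hc : ∀ k, hC.1.eigenvalues k ≤ cE)
    (hαc : (2 * (θ * (m * (1 + 2 / kap'') ^ ν)) + (γ₂ + a')) * cE ≤ 1 / 2) (hg : 0 ≤ g)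
    (hΓq : ∀ X : Λ ⊕ C₀ → ℝ, (Γ₀ *ᵥ X) ⬝ᵥ (C *ᵥ (Γ₀ *ᵥ X)) ≤ g * (X ⬝ᵥ X))
    (hsmall : (2 * (θ * (m * (1 + 2 / kap'') ^ ν)) + (γ₂ + a')) * (1 + 2 * cE * g) ≤ 1 / 2)
    -- constant matching, p. 17, in the primed letters, at the SMALLER radius r₁
    {a a₅ : ℝ} (hPa : a ≤ γ₂ * r₁ ^ 2)
    (hvol : 2 * (K₀ * (m * (1 + 2 / kap) ^ ν) * (θ * (m * (1 + 2 / kap'') ^ ν))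
              * (1 + (1 - K₀ * (m * (1 + 2 / kap) ^ ν) * (θ * (m * (1 + 2 / kap'') ^ ν)))⁻¹) / 2)
          * (Fintype.card Λ : ℝ)
        + w' + (2 * (θ * (m * (1 + 2 / kap'') ^ ν)) + (γ₂ + a')) * cE * (Fintype.card Λ : ℝ)
        + (2 * (θ * (m * (1 + 2 / kap'') ^ ν)) + (γ₂ + a')) * (1 + 2 * cE * g) * (Fintype.card (Λ ⊕ C₀) : ℝ)
        ≤ a₅ * ((Z.1).card : ℝ)) :
    ∀ b ∈ ball (1 : ℂ) ρb,
      ‖term214 r lZ lD (core214 (fun σ => b ^ 2 • A σ) (fun σ X => b • Γ σ X)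
          (F214 t.2.card χY₀ χcP Dfam
            (fun Y B => b ^ 2 * ((((s : ℝ) : ℂ) ^ 2)⁻¹ * 𝒲 Y (s • B)) + 𝒪 Y (s • B)))) 0 0‖ ≤
        Real.exp (-(γ₂ / 2 * (rP ^ 2 - r₁ ^ 2))) * (weight L M c Z a t * Real.exp (a₅ * ((Z.1).card : ℝ))) := by
  have ha0 : 0 ≤ 2 * ρ * m₃ := by positivity
  intro b hb
  have h := h226_torus_windowDilated_largeField_of_primitives c hκ₁ hα₆ Z t hpos hhalf hUσ hUτ hUexp hUtau hr hr' hsubτ lZ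
    hlZ lD hlD A Γ χY₀ χcP hχ0 hχc0 Dfam (fun Y B => (((s : ℝ) : ℂ) ^ 2)⁻¹ * 𝒲 Y (clip ρ (s • B)))
    (fun Y B => 𝒪 Y (clip ρ (s • B))) hC Γ₀ hAhol hχm hχcm (measurable_Wclip ρ s h𝒲m) (measurable_Oclip ρ s h𝒪m) hAs G
    hGhol hlin qP h222 hγ₂ hqP hr₁ hP1 ha0 (h220U_clip_perBond_split Dfam Uτ S hs hρ hR hc₃ hc₁ hUτR h0 h1loc h4 hm₃)
    locΛ locN hfibΛ hfibN hkap'' h1 h2 hθE hθΓ hθC hKG hKΓ hKCs hK₀ hKE hG hΓ₀ hCs hC216 hCE hdΓ hdC hdE hρb1 hKG' hKCs'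
    hθΓ' hθC' hθE' ha' hw' hθEle hθΓle hθR1le hsmallKθ hc0 hc hαc hg hΓq hsmall hPa hvol hb
  rw [← F214_clip_eq_member t.2.card χY₀ χcP Dfam S₀ hbox hloc𝒲 hloc𝒪 b]
  exact h

end LargeField

end Literature.MathematicalPhysics.QuantumFieldTheory.Balaban1983to89.B13Term214WindowDilatedUnscaled

end
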